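import Literature.Geometry.Kaehler.PluriharmonicLog
import Literature.AlgebraicTopology.SingularHomology.CircleIntegralCocycle
import Mathlib.MeasureTheory.Integral.IntervalIntegral.FundThmCalculus
import Mathlib.Analysis.Calculus.MeanValue
import HarnessLib

/-!
# The closed `1`-form `dφ` of a circle-valued map with smooth local lifts, and its periods

Topic `Literature/Geometry/Manifold`.  R. Bott, L. W. Tu, *Differential Forms in Algebraic Topology*
(1982), §2 (the Mayer–Vietoris coboundary of a locally constant function is a closed `1`-form glued
from `d` of local functions) and the classical dictionary "maps to `S¹` ↔ closed `1`-forms with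
integral periods"; everything below is proved from first principles: a map `φ : M → ℝ/ℤ` on a
manifold `M` which near every point is `F mod 1` for a smooth real function `F` ("smooth local
lifts") has a well-defined differential

  `dφ := d F` near each point (`circleMapForm`),

independent of the lift (two continuous lifts differ locally by an INTEGER constant,
`eventually_sub_eq_const_of_lifts`), a smooth (`isSmoothForm_circleMapForm`) and closed
(`mextDeriv_circleMapForm`) `1`-form.  Along a smooth curve `γ : ℝ → M` the function
`t ↦ dφ(γ̇(t))` is continuous and is the derivative of a GLOBAL continuous real lift `Λ` of
`φ ∘ γ` (`exists_lift_along`: analytic continuation of local lifts along the curve, by a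
connectedness argument on `ℝ`), so that

  `∫ₐᵇ dφ(γ̇) dt = Λ(b) − Λ(a)` (`integral_circleMapForm_velocity`),

and the periods over closed curves are integers (`exists_int_integral_circleMapForm`):
the degree of `φ ∘ γ`.  This is the de Rham side of the winding functional of
`Literature/AlgebraicTopology/SingularHomology/CircleMapWinding.lean`; first client: the dual closed
`1`-forms of the vanishing cycles of a positive allowable Lefschetz fibration over the disc
(`Literature.Geometry.Symplectic.palf_stein_supportedByBoundaryOpenBook`, Legendrian realisation).

Everything is proved; the file introduces one definition (`circleMapForm`) and no named fact.

## References
* R. Bott, L. W. Tu, *Differential Forms in Algebraic Topology*, GTM 82 (1982), §2, Prop. 2.3 and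
  the explicit coboundary operator after its proof. [BottTu1982Forms]
* F. W. Warner, *Foundations of Differentiable Manifolds and Lie Groups*, GTM 94 (1983), 2.20
  (`d` on functions). [WarnerGTM94]
-/

noncomputable section

open scoped Manifold ContDiff Topology
open Set Function Filter
open Literature.Geometry.Kaehler
open Literature.AlgebraicTopology.SingularHomology (exists_int_eq_sub_of_coe_eq coe_add_intCast)

namespace Literature.Geometry.Manifold

variable {E : Type*} [NormedAddCommGroup E] [NormedSpace ℝ E] {H : Type*} [TopologicalSpace H]
  {I : ModelWithCorners ℝ E H} {M : Type*} [TopologicalSpace M] [ChartedSpace H M]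

/-! ### Lifts through `ℝ → ℝ/ℤ` -/

section Lifts

/-- **Two continuous local lifts differ by a locally constant integer**: if `φ = F₁ = F₂ mod 1`
near `p` with `F₁`, `F₂` continuous at `p`, then `F₁ − F₂` is constant near `p`.
[cite: BottTu1982Forms, §2 Prop. 2.3] -/
theorem eventually_sub_eq_const_of_lifts {X : Type*} [TopologicalSpace X] {φ : X → UnitAddCircle}
    {F₁ F₂ : X → ℝ} {p : X} (h₁ : ContinuousAt F₁ p) (h₂ : ContinuousAt F₂ p)
    (hl₁ : ∀ᶠ q in 𝓝 p, φ q = ((F₁ q : ℝ) : UnitAddCircle))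
    (hl₂ : ∀ᶠ q in 𝓝 p, φ q = ((F₂ q : ℝ) : UnitAddCircle)) :
    ∀ᶠ q in 𝓝 p, F₁ q - F₂ q = F₁ p - F₂ p := by
  have hD : ContinuousAt (fun q => F₁ q - F₂ q) p := h₁.sub h₂
  have hsmall : ∀ᶠ q in 𝓝 p, F₁ q - F₂ q ∈ Metric.ball (F₁ p - F₂ p) (1 / 2) :=
    hD (Metric.ball_mem_nhds _ (by norm_num))
  obtain ⟨k₀, hk₀⟩ := exists_int_eq_sub_of_coe_eq (hl₁.self_of_nhds.symm.trans hl₂.self_of_nhds)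
  filter_upwards [hsmall, hl₁, hl₂] with q hq h1 h2
  obtain ⟨k, hk⟩ := exists_int_eq_sub_of_coe_eq (h1.symm.trans h2)
  rw [Metric.mem_ball, Real.dist_eq, hk, hk₀] at hq
  have hq' : |((k - k₀ : ℤ) : ℝ)| < 1 / 2 := by
    push_cast
    convert hq using 2
    ring
  have hkk : k = k₀ := by
    have h3 : |k - k₀| < 1 := by
      have h4 : ((|k - k₀| : ℤ) : ℝ) < 1 := by
        rw [Int.cast_abs]; linarith
      exact_mod_cast h4
    have h5 := Int.abs_lt_one_iff.1 h3
    omega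
  rw [hk, hk₀, hkk]
  ring

/-- A map with continuous local lifts is continuous. [folklore] -/
theorem continuous_of_local_lifts {X : Type*} [TopologicalSpace X] {φ : X → UnitAddCircle}
    (hφ : ∀ p, ∃ (W : Set X) (F : X → ℝ), IsOpen W ∧ p ∈ W ∧ (∀ q ∈ W, ContinuousAt F q) ∧
      ∀ q ∈ W, φ q = ((F q : ℝ) : UnitAddCircle)) : Continuous φ := by
  rw [continuous_iff_continuousAt]
  intro p
  obtain ⟨W, F, hW, hp, hF, hl⟩ := hφ p
  have hc : ContinuousAt (fun q => ((F q : ℝ) : UnitAddCircle)) p :=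
    continuous_quotient_mk'.continuousAt.comp (hF p hp)
  refine hc.congr_of_eventuallyEq ?_
  filter_upwards [hW.mem_nhds hp] with q hq
  exact hl q hq

end Lifts

/-! ### `d` of lifts -/

section DLift

variable [IsManifold I ∞ M]

/-- **`d F₁ = d F₂` at `p` for functions differing by a constant near `p`.** [folklore] -/
theorem mextDeriv_ofFun_eq_of_eventually_sub_eq {F₁ F₂ : M → ℝ} {p : M} {c : ℝ}
    (h : ∀ᶠ q in 𝓝 p, F₁ q - F₂ q = c) :
    mextDeriv (MForm.ofFun I F₁) p = mextDeriv (MForm.ofFun I F₂) p := by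
  have hev : ∀ᶠ q in 𝓝 p, MForm.ofFun I F₁ q = MForm.ofFun I (fun z => F₂ z + c) q := by
    filter_upwards [h] with q hq
    have e : F₁ q = F₂ q + c := by linarith
    ext v
    rw [MForm.ofFun_apply, MForm.ofFun_apply, e]
  rw [mextDeriv_congr_of_eventuallyEq hev]
  ext v
  rw [mextDeriv_ofFun_apply, mextDeriv_ofFun_apply]
  have e : ((fun z => F₂ z + c) ∘ (extChartAt I p).symm) =
      fun y => (F₂ ∘ (extChartAt I p).symm) y + c := rfl
  rw [e, fderivWithin_add_const]

/-- **`dF(γ̇(t)) = (F ∘ γ)'(t)`** for `F` differentiable at `γ t` and `γ` differentiable at `t`.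
[folklore] -/
theorem mextDeriv_ofFun_velocity {F : M → ℝ} {γ : ℝ → M} {t : ℝ}
    (hF : MDifferentiableAt I 𝓘(ℝ, ℝ) F (γ t)) (hγ : MDifferentiableAt 𝓘(ℝ, ℝ) I γ t) :
    mextDeriv (MForm.ofFun I F) (γ t) ![mfderiv 𝓘(ℝ, ℝ) I γ t (1 : ℝ)] = deriv (F ∘ γ) t := by
  -- `d` of a `0`-form on a vector is the manifold derivative (as in
  -- `Literature.Geometry.Symplectic.mextDeriv_ofFun_apply_eq_mfderiv`, not imported here)
  have h0 : mextDeriv (MForm.ofFun I F) (γ t) ![mfderiv 𝓘(ℝ, ℝ) I γ t (1 : ℝ)] =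
      mfderiv I 𝓘(ℝ, ℝ) F (γ t) (mfderiv 𝓘(ℝ, ℝ) I γ t (1 : ℝ)) := by
    rw [mextDeriv_ofFun_apply, hF.mfderiv]
    simp only [writtenInExtChartAt, extChartAt_model_space_eq_id, PartialEquiv.refl_coe,
      Function.id_comp, Matrix.cons_val_zero]
    rfl
  rw [h0]
  have hcomp : mfderiv 𝓘(ℝ, ℝ) 𝓘(ℝ, ℝ) (F ∘ γ) t = (mfderiv I 𝓘(ℝ, ℝ) F (γ t)).comp
      (mfderiv 𝓘(ℝ, ℝ) I γ t) := mfderiv_comp t hF hγ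
  rw [← ContinuousLinearMap.comp_apply, ← hcomp, mfderiv_eq_fderiv]
  exact fderiv_apply_one_eq_deriv (𝕜 := ℝ) (f := F ∘ γ) (x := t)

end DLift

/-! ### The form `dφ` -/

section Form

variable (I) in
/-- **The differential `dφ` of a circle-valued map with smooth local lifts**: at `p`, `d` of the
lift chosen at `p` (independent of the choice: `circleMapForm_eq_mextDeriv_ofFun`).
[cite: BottTu1982Forms, §2 Prop. 2.3] -/
def circleMapForm (φ : M → UnitAddCircle)
    (hφ : ∀ p, ∃ (W : Set M) (F : M → ℝ), IsOpen W ∧ p ∈ W ∧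
      (∀ q ∈ W, ContMDiffAt I 𝓘(ℝ, ℝ) ∞ F q) ∧ ∀ q ∈ W, φ q = ((F q : ℝ) : UnitAddCircle)) :
    MForm I M ℝ 1 :=
  fun p => mextDeriv (MForm.ofFun I (hφ p).choose_spec.choose) p

variable [IsManifold I ∞ M] {φ : M → UnitAddCircle}
  {hφ : ∀ p, ∃ (W : Set M) (F : M → ℝ), IsOpen W ∧ p ∈ W ∧
    (∀ q ∈ W, ContMDiffAt I 𝓘(ℝ, ℝ) ∞ F q) ∧ ∀ q ∈ W, φ q = ((F q : ℝ) : UnitAddCircle)}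

/-- **Independence of the lift**: for ANY smooth local lift `F` of `φ` near `p`,
`dφ(p) = dF(p)`. [cite: BottTu1982Forms, §2 Prop. 2.3] -/
theorem circleMapForm_eq_mextDeriv_ofFun {p : M} {W : Set M} {F : M → ℝ} (hW : IsOpen W)
    (hp : p ∈ W) (hF : ∀ q ∈ W, ContMDiffAt I 𝓘(ℝ, ℝ) ∞ F q)
    (hl : ∀ q ∈ W, φ q = ((F q : ℝ) : UnitAddCircle)) :
    circleMapForm I φ hφ p = mextDeriv (MForm.ofFun I F) p := by
  obtain ⟨hW₀, hp₀, hF₀, hl₀⟩ := (hφ p).choose_spec.choose_spec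
  set W₀ := (hφ p).choose
  set F₀ := (hφ p).choose_spec.choose
  show mextDeriv (MForm.ofFun I F₀) p = mextDeriv (MForm.ofFun I F) p
  have hl₀' : ∀ᶠ q in 𝓝 p, φ q = ((F₀ q : ℝ) : UnitAddCircle) := by
    filter_upwards [hW₀.mem_nhds hp₀] with q hq using hl₀ q hq
  have hl' : ∀ᶠ q in 𝓝 p, φ q = ((F q : ℝ) : UnitAddCircle) := by
    filter_upwards [hW.mem_nhds hp] with q hq using hl q hq
  exact mextDeriv_ofFun_eq_of_eventually_sub_eq (c := F₀ p - F p)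
    (eventually_sub_eq_const_of_lifts (hF₀ p hp₀).continuousAt (hF p hp).continuousAt hl₀' hl')

/-- `dφ` agrees NEAR `p` with `dF` for a smooth local lift `F` on a neighbourhood of `p`.
[folklore] -/
theorem circleMapForm_eventuallyEq {p : M} {W : Set M} {F : M → ℝ} (hW : IsOpen W)
    (hp : p ∈ W) (hF : ∀ q ∈ W, ContMDiffAt I 𝓘(ℝ, ℝ) ∞ F q)
    (hl : ∀ q ∈ W, φ q = ((F q : ℝ) : UnitAddCircle)) :
    ∀ᶠ q in 𝓝 p, circleMapForm I φ hφ q = mextDeriv (MForm.ofFun I F) q := by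
  filter_upwards [hW.mem_nhds hp] with q hq
  exact circleMapForm_eq_mextDeriv_ofFun hW hq hF hl

/-- **`dφ` is a smooth `1`-form.** [cite: BottTu1982Forms, §2 Prop. 2.3] -/
theorem isSmoothForm_circleMapForm : IsSmoothForm (circleMapForm I φ hφ) := fun p => by
  obtain ⟨W, F, hW, hp, hF, hl⟩ := hφ p
  have hsm : ∀ᶠ z in 𝓝 p, (MForm.ofFun I F).SmoothAt z := by
    filter_upwards [hW.mem_nhds hp] with z hz
    exact MForm.smoothAt_ofFun_of_contMDiffAt (hF z hz)
  have h1 : (mextDeriv (MForm.ofFun I F)).SmoothAt p := MForm.SmoothAt.mextDeriv hsm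
  exact h1.congr_of_eventuallyEq
    ((circleMapForm_eventuallyEq hW hp hF hl).mono fun q h => h.symm)

/-- **`dφ` is closed**: `d(dφ) = 0`. [cite: BottTu1982Forms, §2 Prop. 2.3] -/
theorem mextDeriv_circleMapForm (p : M) : mextDeriv (circleMapForm I φ hφ) p = 0 := by
  obtain ⟨W, F, hW, hp, hF, hl⟩ := hφ p
  have hsm : ∀ᶠ z in 𝓝 p, (MForm.ofFun I F).SmoothAt z := by
    filter_upwards [hW.mem_nhds hp] with z hz
    exact MForm.smoothAt_ofFun_of_contMDiffAt (hF z hz)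
  rw [mextDeriv_congr_of_eventuallyEq (circleMapForm_eventuallyEq hW hp hF hl)]
  exact mextDeriv_mextDeriv_of_smoothAt hsm

omit [IsManifold I ∞ M] in
/-- `φ` is continuous. [folklore] -/
theorem continuous_of_smooth_lifts (hφ : ∀ p, ∃ (W : Set M) (F : M → ℝ), IsOpen W ∧ p ∈ W ∧
      (∀ q ∈ W, ContMDiffAt I 𝓘(ℝ, ℝ) ∞ F q) ∧ ∀ q ∈ W, φ q = ((F q : ℝ) : UnitAddCircle)) :
    Continuous φ :=
  continuous_of_local_lifts fun p => by
    obtain ⟨W, F, hW, hp, hF, hl⟩ := hφ p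
    exact ⟨W, F, hW, hp, fun q hq => (hF q hq).continuousAt, hl⟩

/-! ### Along a smooth curve: `dφ(γ̇)` is the derivative of a global lift of `φ ∘ γ` -/

/-- **`dφ(γ̇(t)) = (F ∘ γ)'(t)`** for a smooth local lift `F` at `γ t`. [folklore] -/
theorem circleMapForm_velocity {γ : ℝ → M} (hγ : ContMDiff 𝓘(ℝ, ℝ) I ∞ γ) {t : ℝ} {W : Set M}
    {F : M → ℝ} (hW : IsOpen W) (ht : γ t ∈ W) (hF : ∀ q ∈ W, ContMDiffAt I 𝓘(ℝ, ℝ) ∞ F q)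
    (hl : ∀ q ∈ W, φ q = ((F q : ℝ) : UnitAddCircle)) :
    circleMapForm I φ hφ (γ t) ![mfderiv 𝓘(ℝ, ℝ) I γ t (1 : ℝ)] = deriv (F ∘ γ) t := by
  rw [circleMapForm_eq_mextDeriv_ofFun hW ht hF hl]
  exact mextDeriv_ofFun_velocity ((hF _ ht).mdifferentiableAt (by simp))
    ((hγ t).mdifferentiableAt (by simp))

/-- Near `t`, `dφ(γ̇)` is the derivative of `F ∘ γ` for a smooth local lift `F` at `γ t`, and
`F ∘ γ` is smooth there. [folklore] -/
theorem circleMapForm_velocity_eventuallyEq {γ : ℝ → M} (hγ : ContMDiff 𝓘(ℝ, ℝ) I ∞ γ) {t : ℝ}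
    {W : Set M} {F : M → ℝ} (hW : IsOpen W) (ht : γ t ∈ W)
    (hF : ∀ q ∈ W, ContMDiffAt I 𝓘(ℝ, ℝ) ∞ F q) (hl : ∀ q ∈ W, φ q = ((F q : ℝ) : UnitAddCircle)) :
    ∀ᶠ s in 𝓝 t, circleMapForm I φ hφ (γ s) ![mfderiv 𝓘(ℝ, ℝ) I γ s (1 : ℝ)] = deriv (F ∘ γ) s ∧
      ContDiffAt ℝ ∞ (F ∘ γ) s := by
  have hN : {s | γ s ∈ W} ∈ 𝓝 t := (hW.preimage hγ.continuous).mem_nhds ht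
  filter_upwards [hN] with s hs
  refine ⟨circleMapForm_velocity hγ hW hs hF hl, ?_⟩
  exact ((hF _ hs).comp s (hγ s)).contDiffAt

/-- **`t ↦ dφ(γ̇(t))` is continuous** along a smooth curve. [folklore] -/
theorem continuous_circleMapForm_velocity {γ : ℝ → M} (hγ : ContMDiff 𝓘(ℝ, ℝ) I ∞ γ) :
    Continuous fun t => circleMapForm I φ hφ (γ t) ![mfderiv 𝓘(ℝ, ℝ) I γ t (1 : ℝ)] := by
  rw [continuous_iff_continuousAt]
  intro t
  obtain ⟨W, F, hW, ht, hF, hl⟩ := hφ (γ t)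
  have hev := circleMapForm_velocity_eventuallyEq (hφ := hφ) hγ hW ht hF hl
  have hcd : ContDiffAt ℝ ∞ (F ∘ γ) t := (hev.self_of_nhds).2
  have hder : ContinuousAt (deriv (F ∘ γ)) t := by
    have h1 : ContDiffAt ℝ ∞ (fderiv ℝ (F ∘ γ)) t :=
      hcd.fderiv_right (m := ∞) (by simp)
    have h2 : ContinuousAt (fun s => fderiv ℝ (F ∘ γ) s (1 : ℝ)) t :=
      ((ContinuousLinearMap.apply ℝ ℝ (1 : ℝ)).continuous.continuousAt).comp h1.continuousAt
    exact h2
  exact hder.congr_of_eventuallyEq (hev.mono fun s hs => hs.1)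

/-- Calculus lemma: a function with derivative `0` on an open interval is constant there.
[folklore] -/
theorem eq_of_hasDerivAt_zero_Ioo {D : ℝ → ℝ} {a b t t₀ : ℝ}
    (hD : ∀ s ∈ Ioo a b, HasDerivAt D 0 s) (ht : t ∈ Ioo a b) (ht₀ : t₀ ∈ Ioo a b) :
    D t = D t₀ := by
  have hsub : Icc (min t t₀) (max t t₀) ⊆ Ioo a b := fun x hx =>
    ⟨lt_of_lt_of_le (lt_min ht.1 ht₀.1) hx.1, lt_of_le_of_lt hx.2 (max_lt ht.2 ht₀.2)⟩
  have hcont : ContinuousOn D (Icc (min t t₀) (max t t₀)) := fun x hx =>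
    (hD x (hsub hx)).continuousAt.continuousWithinAt
  have hder : ∀ x ∈ Ico (min t t₀) (max t t₀), HasDerivWithinAt D 0 (Ici x) x := fun x hx =>
    (hD x (hsub (Ico_subset_Icc_self hx))).hasDerivWithinAt
  have h := constant_of_has_deriv_right_zero hcont hder
  rw [h t ⟨min_le_left _ _, le_max_left _ _⟩, h t₀ ⟨min_le_right _ _, le_max_right _ _⟩]

/-- **Analytic continuation of lifts along a curve.**  For a smooth curve `γ : ℝ → M` there is a
real function `Λ` with `Λ mod 1 = φ ∘ γ` and `Λ' = dφ(γ̇)` everywhere: the primitive of the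
continuous function `dφ(γ̇)` starting at a lift of `φ(γ 0)`; the set where it lifts `φ ∘ γ` is
closed and open (locally `Λ − F ∘ γ` is constant, and an integer at one point), hence all of `ℝ`.
[cite: BottTu1982Forms, §2 Prop. 2.3] -/
theorem exists_lift_along {γ : ℝ → M} (hγ : ContMDiff 𝓘(ℝ, ℝ) I ∞ γ) :
    ∃ Λ : ℝ → ℝ, (∀ t, ((Λ t : ℝ) : UnitAddCircle) = φ (γ t)) ∧
      ∀ t, HasDerivAt Λ (circleMapForm I φ hφ (γ t) ![mfderiv 𝓘(ℝ, ℝ) I γ t (1 : ℝ)]) t := by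
  set g : ℝ → ℝ := fun t => circleMapForm I φ hφ (γ t) ![mfderiv 𝓘(ℝ, ℝ) I γ t (1 : ℝ)] with hg
  have hgc : Continuous g := continuous_circleMapForm_velocity hγ
  obtain ⟨W₀, F₀, hW₀, h0, hF₀, hl₀⟩ := hφ (γ 0)
  set Λ : ℝ → ℝ := fun t => F₀ (γ 0) + ∫ s in (0 : ℝ)..t, g s with hΛ
  have hderiv : ∀ t, HasDerivAt Λ (g t) t := fun t => by
    have h := intervalIntegral.integral_hasDerivAt_right (hgc.intervalIntegrable 0 t)
      (hgc.stronglyMeasurableAtFilter _ _) hgc.continuousAt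
    exact h.const_add _
  have hΛc : Continuous Λ := continuous_iff_continuousAt.2 fun t => (hderiv t).continuousAt
  have hφc : Continuous φ := continuous_of_smooth_lifts hφ
  -- the set where `Λ` lifts `φ ∘ γ` is all of `ℝ`
  set S : Set ℝ := {t | ((Λ t : ℝ) : UnitAddCircle) = φ (γ t)} with hS
  have hS0 : (0 : ℝ) ∈ S := by
    show (((F₀ (γ 0) + ∫ s in (0 : ℝ)..0, g s) : ℝ) : UnitAddCircle) = φ (γ 0)
    rw [intervalIntegral.integral_same, add_zero, hl₀ _ h0]
  have hSc : IsClosed S :=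
    isClosed_eq (continuous_quotient_mk'.comp hΛc) (hφc.comp hγ.continuous)
  have hSo : IsOpen S := by
    rw [isOpen_iff_mem_nhds]
    intro t₀ ht₀S
    obtain ⟨W, F, hW, ht₀, hF, hl⟩ := hφ (γ t₀)
    obtain ⟨δ, hδ, hballW⟩ := Metric.isOpen_iff.1 (hW.preimage hγ.continuous) t₀ ht₀
    have hJW : ∀ s ∈ Ioo (t₀ - δ) (t₀ + δ), γ s ∈ W := fun s hs =>
      hballW (by rw [Real.ball_eq_Ioo]; exact hs)
    -- `Λ − F ∘ γ` has derivative `0` on the interval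
    have hD : ∀ s ∈ Ioo (t₀ - δ) (t₀ + δ), HasDerivAt (fun u => Λ u - F (γ u)) 0 s := by
      intro s hs
      have h1 : g s = deriv (F ∘ γ) s := circleMapForm_velocity hγ hW (hJW s hs) hF hl
      have h2 : ContDiffAt ℝ ∞ (F ∘ γ) s := ((hF _ (hJW s hs)).comp s (hγ s)).contDiffAt
      have h3 : HasDerivAt (F ∘ γ) (deriv (F ∘ γ) s) s :=
        (h2.differentiableAt (by simp)).hasDerivAt
      have h4 := (hderiv s).sub h3
      rwa [h1, sub_self] at h4
    have ht₀J : t₀ ∈ Ioo (t₀ - δ) (t₀ + δ) := ⟨by linarith, by linarith⟩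
    obtain ⟨k, hk⟩ := exists_int_eq_sub_of_coe_eq (ht₀S.trans (hl _ ht₀))
    refine Filter.mem_of_superset (Ioo_mem_nhds ht₀J.1 ht₀J.2) fun t ht => ?_
    have hc : Λ t - F (γ t) = Λ t₀ - F (γ t₀) := eq_of_hasDerivAt_zero_Ioo hD ht ht₀J
    show ((Λ t : ℝ) : UnitAddCircle) = φ (γ t)
    have e : Λ t = F (γ t) + k := by linarith
    rw [e, coe_add_intCast, hl _ (hJW t ht)]
  have hSu : S = univ := IsClopen.eq_univ ⟨hSc, hSo⟩ ⟨0, hS0⟩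
  refine ⟨Λ, fun t => ?_, hderiv⟩
  have : t ∈ S := by rw [hSu]; exact mem_univ t
  exact this

/-- **The integral of `dφ(γ̇)` is the increment of a lift**: `∫ₐᵇ dφ(γ̇) dt = Λ(b) − Λ(a)` for
any `Λ` with `Λ' = dφ(γ̇)` (in particular the lift of `exists_lift_along`). [folklore] -/
theorem integral_circleMapForm_velocity {γ : ℝ → M} (hγ : ContMDiff 𝓘(ℝ, ℝ) I ∞ γ) {Λ : ℝ → ℝ}
    (hΛ : ∀ t, HasDerivAt Λ (circleMapForm I φ hφ (γ t) ![mfderiv 𝓘(ℝ, ℝ) I γ t (1 : ℝ)]) t)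
    (a b : ℝ) :
    (∫ t in a..b, circleMapForm I φ hφ (γ t) ![mfderiv 𝓘(ℝ, ℝ) I γ t (1 : ℝ)]) = Λ b - Λ a :=
  intervalIntegral.integral_eq_sub_of_hasDerivAt (fun t _ => hΛ t)
    ((continuous_circleMapForm_velocity hγ).intervalIntegrable a b)

/-- **Periods are integers**: over a closed smooth curve (`γ T = γ 0`) the integral of `dφ(γ̇)`
is an integer — the degree of `φ ∘ γ`. [cite: BottTu1982Forms, §2 Prop. 2.3] -/
theorem exists_int_integral_circleMapForm {γ : ℝ → M} (hγ : ContMDiff 𝓘(ℝ, ℝ) I ∞ γ) {T : ℝ}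
    (hT : γ T = γ 0) :
    ∃ k : ℤ, (∫ t in (0 : ℝ)..T, circleMapForm I φ hφ (γ t) ![mfderiv 𝓘(ℝ, ℝ) I γ t (1 : ℝ)]) = k := by
  obtain ⟨Λ, hlift, hΛ⟩ := exists_lift_along (hφ := hφ) hγ
  have h1 : ((Λ T : ℝ) : UnitAddCircle) = ((Λ 0 : ℝ) : UnitAddCircle) := by
    rw [hlift T, hlift 0, hT]
  obtain ⟨k, hk⟩ := exists_int_eq_sub_of_coe_eq h1
  refine ⟨k, ?_⟩
  rw [integral_circleMapForm_velocity hγ hΛ, hk]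
  ring

end Form

end Literature.Geometry.Manifold
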